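import Summits.ResolutionOfSingularities.ResolutionOfSingularities.Theorems.RisoStrataRisoCentresResolvePCuspTools
import Summits.ResolutionOfSingularities.ResolutionOfSingularities.Theorems.RisoStrataRisoCentresResolveToricTVertex

/-!
# Route RisoStrata — crux `RisoCentresResolve` (stmt-ResolutionOfSingularities-18546), line `Sketch`:
# typed `Rtd` VANISHES at the vertex of the toric fourfold `T` (sub-goal `toricT_vertex_not_rtd_one`)

Lead c2. `T = Spec k[S_T]` is the chart on which the constant top word of the crux's schedule
recurs (`Cruxes/RisoCentresResolve/ConstantTopWordDead.md`); the disprover's standing dichotomy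
(`Disproof.lean` §D(iii)) was whether typed `rtd` vanishes at its vertex (else every letter acts
on `T` as `top` and the crux is false). It does: `ta_exists_monomial_arc` (monomial arcs of
subalgebras of `k[t₀,…,t₃][(t₁t₂t₃)⁻¹]`, by a localisation lift), `ta_arc_centred`,
`ta_vertex_arc`, and `toricT_vertex_not_rtd_one` (from the landed abstract core
`toricT_vertex_core` and cotangent invariance `stub_invariance`). With `rtd_product_pad` (product
directions have positive typed rtd) this validates the alphabet `{0 ↦ vertex, ≥1 ↦ (Sing T)_red}`
of the toric analyses: `T` is resolved by the schedule `(0, top)` in the typed semantics.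
Mathlib + tree only; no definitions, no named facts.
-/

noncomputable section

set_option linter.dupNamespace false

namespace Summit.ResolutionOfSingularities.ResolutionOfSingularities.Theorems

open Summit.ResolutionOfSingularities.ResolutionOfSingularities.Theses.RisoStrata

section ToricArcs

variable {k : Type} [Field k]

/-- `(t^a)⁻¹ = t^{-a}` in the Hahn field. -/
theorem ta_single_inv (a : ℚ) :
    (HahnSeries.single a (1 : k))⁻¹ = HahnSeries.single (-a) (1 : k) := by
  apply inv_eq_of_mul_eq_one_right
  rw [HahnSeries.single_mul_single, add_neg_cancel, mul_one]
  rfl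

/-- **Monomial arcs.** For weights `lam : Fin 4 → ℚ` and every `k`-subalgebra `B` of
`k(t₀,…,t₃)` contained in `k[t₀,…,t₃][(t₁t₂t₃)⁻¹]` there is a `k`-algebra map
`B → k⟦t^ℚ⟧` sending (the restriction of) `q · (t₁t₂t₃)^{-e}` to
`q(t^{lam 0},…,t^{lam 3}) · t^{-e (lam 1 + lam 2 + lam 3)}`. -/
theorem ta_exists_monomial_arc (lam : Fin 4 → ℚ)
    (B : Subalgebra k (FractionRing (MvPolynomial (Fin 4) k)))
    (hB : B ≤ Algebra.adjoin k
      (((IsScalarTower.toAlgHom k (MvPolynomial (Fin 4) k) (FractionRing (MvPolynomial (Fin 4) k))).range :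
        Set (FractionRing (MvPolynomial (Fin 4) k))) ∪
        {(algebraMap (MvPolynomial (Fin 4) k) (FractionRing (MvPolynomial (Fin 4) k))
          (MvPolynomial.X 1 * MvPolynomial.X 2 * MvPolynomial.X 3))⁻¹})) :
    ∃ α : ↥B →ₐ[k] HahnSeries ℚ k, ∀ (b : ↥B) (q : MvPolynomial (Fin 4) k) (e : ℕ),
      (b : FractionRing (MvPolynomial (Fin 4) k)) =
        algebraMap (MvPolynomial (Fin 4) k) (FractionRing (MvPolynomial (Fin 4) k)) q *
          ((algebraMap (MvPolynomial (Fin 4) k) (FractionRing (MvPolynomial (Fin 4) k))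
            (MvPolynomial.X 1 * MvPolynomial.X 2 * MvPolynomial.X 3)) ^ e)⁻¹ →
      α b = MvPolynomial.aeval (fun i => HahnSeries.single (lam i) (1 : k)) q *
        HahnSeries.single (-((e : ℚ) * (lam 1 + lam 2 + lam 3))) (1 : k) := by
  set K := FractionRing (MvPolynomial (Fin 4) k) with hKdef
  set ι := IsScalarTower.toAlgHom k (MvPolynomial (Fin 4) k) K with hι
  set sP : MvPolynomial (Fin 4) k := MvPolynomial.X 1 * MvPolynomial.X 2 * MvPolynomial.X 3 with hsP
  set s : K := algebraMap (MvPolynomial (Fin 4) k) K sP with hsdef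
  have hιapp : ∀ q, ι q = algebraMap (MvPolynomial (Fin 4) k) K q := fun q => rfl
  -- the polynomial ring as a subalgebra of K and the evaluation map on it
  set Pol : Subalgebra k K := ι.range with hPol
  set e := AlgEquiv.ofInjective ι (IsFractionRing.injective (MvPolynomial (Fin 4) k) K) with he
  set f₀ : ↥Pol →ₐ[k] HahnSeries ℚ k :=
    (MvPolynomial.aeval fun i => HahnSeries.single (lam i) (1 : k)).comp
      (e.symm : ↥Pol →ₐ[k] MvPolynomial (Fin 4) k) with hf₀
  have hf₀val : ∀ q, f₀ (e q) = MvPolynomial.aeval (fun i => HahnSeries.single (lam i) (1 : k)) q := by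
    intro q
    rw [hf₀, AlgHom.comp_apply]
    exact congrArg _ (e.symm_apply_apply q)
  have hsPol : s ∈ Pol := ⟨sP, rfl⟩
  have hsP0 : sP ≠ 0 := by
    rw [hsP]
    exact mul_ne_zero (mul_ne_zero (MvPolynomial.X_ne_zero _) (MvPolynomial.X_ne_zero _))
      (MvPolynomial.X_ne_zero _)
  have hs0 : s ≠ 0 := by
    rw [hsdef]
    exact (map_ne_zero_iff _ (IsFractionRing.injective (MvPolynomial (Fin 4) k) K)).mpr hsP0
  -- the localisation R' = Pol[s⁻¹]
  set R' : Subalgebra k K := Algebra.adjoin k ((Pol : Set K) ∪ {s⁻¹}) with hR'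
  have hleR : Pol ≤ R' := fun x hx => Algebra.subset_adjoin (Set.mem_union_left _ hx)
  letI := (Subalgebra.inclusion hleR).toRingHom.toAlgebra
  haveI hloc := arcEquiv_isLocalization (k := k) hsPol hs0 hleR
  have halg : ∀ b : ↥Pol, algebraMap ↥Pol ↥R' b = Subalgebra.inclusion hleR b := fun _ => rfl
  haveI : IsScalarTower k ↥Pol ↥R' := IsScalarTower.of_algebraMap_eq (fun x => rfl)
  -- f₀ inverts the powers of s
  have hse : e sP = ⟨s, hsPol⟩ := by
    apply Subtype.ext
    rw [he, AlgEquiv.ofInjective_apply]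
    show ι sP = s
    rw [hιapp, hsdef]
  have hf₀s : f₀ ⟨s, hsPol⟩ = HahnSeries.single (lam 1 + lam 2 + lam 3) (1 : k) := by
    rw [← hse, hf₀val, hsP, map_mul, map_mul, MvPolynomial.aeval_X, MvPolynomial.aeval_X,
      MvPolynomial.aeval_X, HahnSeries.single_mul_single, HahnSeries.single_mul_single, mul_one, mul_one]
  have hunit : ∀ y : Submonoid.powers (⟨s, hsPol⟩ : ↥Pol), IsUnit (f₀ y) := by
    rintro ⟨y, n, rfl⟩
    rw [map_pow, hf₀s, isUnit_iff_ne_zero]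
    exact pow_ne_zero _ (by rw [Ne, HahnSeries.single_eq_zero_iff]; exact one_ne_zero)
  set ψ : ↥R' →ₐ[k] HahnSeries ℚ k :=
    IsLocalization.liftAlgHom (M := Submonoid.powers (⟨s, hsPol⟩ : ↥Pol)) (S := ↥R') (f := f₀) hunit with hψ
  have hψalg : ∀ b : ↥Pol, ψ (Subalgebra.inclusion hleR b) = f₀ b := by
    intro b
    rw [← halg, hψ, IsLocalization.liftAlgHom_apply]
    exact IsLocalization.lift_eq hunit b
  -- B ≤ R'
  have hBR : B ≤ R' := hB
  refine ⟨ψ.comp (Subalgebra.inclusion hBR), ?_⟩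
  intro b q n hb
  -- in R': (inclusion b) * s^n = ι q
  have hprod : Subalgebra.inclusion hBR b * Subalgebra.inclusion hleR (⟨s, hsPol⟩ ^ n) =
      Subalgebra.inclusion hleR (e q) := by
    apply Subtype.ext
    simp only [Subalgebra.coe_mul, Subalgebra.coe_inclusion, SubmonoidClass.coe_pow]
    rw [hb, he, AlgEquiv.ofInjective_apply, hιapp, inv_mul_cancel_right₀ (pow_ne_zero n hs0)]
  have h := congrArg ψ hprod
  rw [map_mul, hψalg, hψalg, hf₀val, map_pow, hf₀s, HahnSeries.single_pow] at h
  rw [AlgHom.comp_apply]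
  have hne : (HahnSeries.single (n • (lam 1 + lam 2 + lam 3)) ((1 : k) ^ n)) ≠ 0 := by
    rw [one_pow, Ne, HahnSeries.single_eq_zero_iff]; exact one_ne_zero
  rw [(eq_mul_inv_iff_mul_eq₀ hne).mpr h, one_pow, ta_single_inv, nsmul_eq_mul]

end ToricArcs

section ToricTMain

variable {k : Type} [Field k]

/-- **Arcs centred by their values on a presentation.** If `G` generates `B` as a `k`-algebra,
lies in the proper ideal `m`, and the `k`-algebra map `α` gives every `G i` positive order,
then `α` gives every element of `m` positive order. -/
theorem ta_arc_centred {K : Type} [Field K] [Algebra k K] {B : Subalgebra k K} {m : Ideal ↥B}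
    (hm : m ≠ ⊤) {n : ℕ} (G : Fin n → ↥B) (hG : ∀ i, G i ∈ m)
    (hgen : Algebra.adjoin k (Set.range G) = ⊤) (α : ↥B →ₐ[k] HahnSeries ℚ k)
    (hpos : ∀ i, 0 < (α (G i)).orderTop) : ∀ b ∈ m, 0 < (α b).orderTop := by
  have hnonneg : ∀ b : ↥B, 0 ≤ (α b).orderTop :=
    sqdom_orderTop_nonneg G hgen α (fun j => (hpos j).le)
  intro b hb
  obtain ⟨d, hd⟩ := fin_residue (Ideal.span (Set.range G)) G
    (fun j => Ideal.subset_span ⟨j, rfl⟩) hgen b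
  have hspan_le : Ideal.span (Set.range G) ≤ m :=
    Ideal.span_le.mpr (by rintro _ ⟨j, rfl⟩; exact hG j)
  have hd0 : d = 0 := by
    by_contra hd0
    apply hm
    have hdm : algebraMap k ↥B d ∈ m := by
      have : algebraMap k ↥B d = b - (b - algebraMap k ↥B d) := by ring
      rw [this]
      exact sub_mem hb (hspan_le hd)
    exact m.eq_top_of_isUnit_mem hdm ((IsUnit.mk0 d hd0).map (algebraMap k ↥B))
  rw [hd0, map_zero, sub_zero] at hd
  obtain ⟨r, hr⟩ := Ideal.mem_span_range_iff_exists_fun.mp hd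
  rw [← hr, map_sum]
  refine lt_orderTop_sum (c := 0) Finset.univ _ fun j _ => ?_
  rw [map_mul]
  refine lt_of_lt_of_le ?_ HahnSeries.orderTop_add_le_mul
  exact lt_of_lt_of_le (hpos j) (le_add_of_nonneg_left (hnonneg (r j)))

/-- **The vertex arc.** If `G` generates `B` and lies in the proper ideal `m`, the composite
`B → B/m ≅ k → k⟦t^ℚ⟧` is an arc centred at `m` killing every `G i`. -/
theorem ta_vertex_arc {K : Type} [Field K] [Algebra k K] {B : Subalgebra k K} {m : Ideal ↥B}
    (hm : m ≠ ⊤) {n : ℕ} (G : Fin n → ↥B) (hG : ∀ i, G i ∈ m)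
    (hgen : Algebra.adjoin k (Set.range G) = ⊤) :
    ∃ a₀ : {α : ↥B →ₐ[k] HahnSeries ℚ k // ∀ b ∈ m, 0 < (α b).orderTop}, ∀ i, a₀.1 (G i) = 0 := by
  have hres : ∀ x : ↥B, ∃ c : k, x - algebraMap k ↥B c ∈ m := fun x => by
    obtain ⟨c, hc⟩ := fin_residue (Ideal.span (Set.range G)) G (fun j => Ideal.subset_span ⟨j, rfl⟩) hgen x
    exact ⟨c, Ideal.span_le.mpr (by rintro _ ⟨j, rfl⟩; exact hG j) hc⟩
  haveI : Nontrivial (↥B ⧸ m) := Ideal.Quotient.nontrivial_iff.mpr hm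
  have hinj : Function.Injective (algebraMap k (↥B ⧸ m)) := (algebraMap k (↥B ⧸ m)).injective
  have hsurj : Function.Surjective (algebraMap k (↥B ⧸ m)) := by
    intro y
    obtain ⟨x, rfl⟩ := Ideal.Quotient.mk_surjective y
    obtain ⟨c, hc⟩ := hres x
    refine ⟨c, ?_⟩
    rw [IsScalarTower.algebraMap_apply k ↥B (↥B ⧸ m), Ideal.Quotient.algebraMap_eq, eq_comm,
      Ideal.Quotient.mk_eq_mk_iff_sub_mem]
    exact hc
  let e : k ≃ₐ[k] (↥B ⧸ m) := AlgEquiv.ofBijective (Algebra.ofId k (↥B ⧸ m)) ⟨hinj, hsurj⟩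
  let α : ↥B →ₐ[k] HahnSeries ℚ k :=
    (Algebra.ofId k (HahnSeries ℚ k)).comp (e.symm.toAlgHom.comp (Ideal.Quotient.mkₐ k m))
  have hkill : ∀ b ∈ m, α b = 0 := fun b hb => by
    have h0 : Ideal.Quotient.mk m b = 0 := Ideal.Quotient.eq_zero_iff_mem.2 hb
    simp [α, Ideal.Quotient.mkₐ_eq_mk, h0]
  refine ⟨⟨α, fun b hb => ?_⟩, fun i => hkill _ (hG i)⟩
  rw [hkill b hb, HahnSeries.orderTop_zero]
  exact WithTop.top_pos

/-- **Typed `rtd` vanishes at the vertex of the toric fourfold `T`** (lead c2; answers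
`Disproof.lean` §D(iii)). `K = k(t₀,…,t₃)`, `GK` = the seven monomials
`t₂t₃/t₁, t₃, t₂, t₁, t₀, t₀t₁/t₂, t₀t₁²/(t₂t₃)` (= `t^{gᵢ}`, `S_T = ℕ⟨g₁,…,g₇⟩` of
`ConstantTopWordDead.md`), `B = k[S_T] = Algebra.adjoin k (range GK)`; for every proper ideal `m`
containing the seven monomials (the vertex) the route's inline `Rtd B m 1` is FALSE. Proof:
cotangent invariance moves the straightener to the monomial coordinates; `toricT_vertex_core`
(relations `g₁+g₄ = g₂+g₃`, `g₃+g₆ = g₄+g₅ = g₁+g₇`, the vertex arc, exposing monomial arcs with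
weights `(2,3,2,2)`, `(3,2,3,1)`, `(2,2,1,3)`, `(4,1,2,2)`) kills every direction. Any field `k`.
[folklore] -/
theorem toricT_vertex_not_rtd_one : ∀ (k : Type) [Field k] (t : Fin 4 → FractionRing (MvPolynomial (Fin 4) k)), (∀ i, t i = algebraMap (MvPolynomial (Fin 4) k) (FractionRing (MvPolynomial (Fin 4) k)) (MvPolynomial.X i)) → ∀ (GK : Fin 7 → FractionRing (MvPolynomial (Fin 4) k)), GK = ![t 2 * t 3 * (t 1)⁻¹, t 3, t 2, t 1, t 0, t 0 * t 1 * (t 2)⁻¹, t 0 * t 1 ^ 2 * (t 2)⁻¹ * (t 3)⁻¹] → ∀ (B : Subalgebra k (FractionRing (MvPolynomial (Fin 4) k))), B = Algebra.adjoin k (Set.range GK) → ∀ (m : Ideal ↥B), m ≠ ⊤ → (∀ b : ↥B, (b : FractionRing (MvPolynomial (Fin 4) k)) ∈ Set.range GK → b ∈ m) → ¬ ∃ (n : ℕ) (g : Fin n → ↥B), (∀ i, g i ∈ m) ∧ Algebra.adjoin k (Set.range fun i => (g i : FractionRing (MvPolynomial (Fin 4) k))) = B ∧ ∃ W : Submodule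 k (Fin n → k), 1 ≤ Module.finrank k ↥W ∧ ∃ φ : {α : ↥B →ₐ[k] HahnSeries ℚ k // ∀ b ∈ m, 0 < (α b).orderTop} → (Fin n → HahnSeries ℚ k), (∀ a b : {α : ↥B →ₐ[k] HahnSeries ℚ k // ∀ b ∈ m, 0 < (α b).orderTop}, a ≠ b → ∃ j, ∀ i, (a.1 (g j) - b.1 (g j)).orderTop < ((φ a i - φ b i) - (a.1 (g i) - b.1 (g i))).orderTop) ∧ (∀ a i, 0 < (φ a i).orderTop) ∧ (∀ a, ∀ w : Fin n → HahnSeries ℚ k, (∀ i, 0 < (w i).orderTop) → w ∈ Submodule.span (HahnSeries ℚ k) ((fun u : Fin n → k => fun i => HahnSeries.C (u i)) '' (W : Set (Fin n → k))) → ∃ b, φ b = φ a + w) := by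
  intro k _ t ht GK hGK B hB m hm hGm
  rintro ⟨n, g, hg, hgK, W, hW, φ, h1, h2, h3⟩
  have ht0 : ∀ i, t i ≠ 0 := fun i => by
    rw [ht i]
    exact (map_ne_zero_iff _ (IsFractionRing.injective (MvPolynomial (Fin 4) k)
      (FractionRing (MvPolynomial (Fin 4) k)))).mpr (MvPolynomial.X_ne_zero _)
  have hG0 : GK 0 = t 2 * t 3 * (t 1)⁻¹ := by rw [hGK]; rfl
  have hG1 : GK 1 = t 3 := by rw [hGK]; rfl
  have hG2 : GK 2 = t 2 := by rw [hGK]; rfl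
  have hG3 : GK 3 = t 1 := by rw [hGK]; rfl
  have hG4 : GK 4 = t 0 := by rw [hGK]; rfl
  have hG5 : GK 5 = t 0 * t 1 * (t 2)⁻¹ := by rw [hGK]; rfl
  have hG6 : GK 6 = t 0 * t 1 ^ 2 * (t 2)⁻¹ * (t 3)⁻¹ := by rw [hGK]; rfl
  have hGKB : ∀ i, GK i ∈ B := fun i => hB ▸ Algebra.subset_adjoin ⟨i, rfl⟩
  obtain ⟨G, hG⟩ : ∃ G : Fin 7 → ↥B, ∀ i, (G i : FractionRing (MvPolynomial (Fin 4) k)) = GK i :=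
    ⟨fun i => ⟨GK i, hGKB i⟩, fun i => rfl⟩
  have hGm' : ∀ i, G i ∈ m := fun i => hGm _ ⟨i, (hG i).symm⟩
  have hfun : (fun i => (G i : FractionRing (MvPolynomial (Fin 4) k))) = GK := funext hG
  have hGgenK : Algebra.adjoin k (Set.range fun i => (G i : FractionRing (MvPolynomial (Fin 4) k))) = B := by
    rw [hfun]; exact hB.symm
  have hGgen : Algebra.adjoin k (Set.range G) = ⊤ := adjoin_range_eq_top_of_adjoin_coe_eq B G hGgenK
  -- relations
  have hrelA : G 0 * G 3 = G 1 * G 2 := by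
    apply Subtype.ext
    simp only [Subalgebra.coe_mul, hG, hG0, hG1, hG2, hG3]
    field_simp [ht0 1]
  have hrelB : G 2 * G 5 = G 3 * G 4 := by
    apply Subtype.ext
    simp only [Subalgebra.coe_mul, hG, hG2, hG3, hG4, hG5]
    field_simp [ht0 2]
  have hrelC : G 2 * G 5 = G 0 * G 6 := by
    apply Subtype.ext
    simp only [Subalgebra.coe_mul, hG, hG0, hG2, hG5, hG6]
    field_simp [ht0 1, ht0 2, ht0 3]
  -- the localisation k[t][ (t₁t₂t₃)⁻¹ ] containing B
  set ι := IsScalarTower.toAlgHom k (MvPolynomial (Fin 4) k) (FractionRing (MvPolynomial (Fin 4) k)) with hι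
  set s : FractionRing (MvPolynomial (Fin 4) k) := algebraMap (MvPolynomial (Fin 4) k)
    (FractionRing (MvPolynomial (Fin 4) k)) (MvPolynomial.X 1 * MvPolynomial.X 2 * MvPolynomial.X 3) with hsdef
  have hs : s = t 1 * t 2 * t 3 := by rw [hsdef, map_mul, map_mul, ← ht, ← ht, ← ht]
  have hs0 : s ≠ 0 := by rw [hs]; exact mul_ne_zero (mul_ne_zero (ht0 1) (ht0 2)) (ht0 3)
  have hPol : ∀ q, algebraMap (MvPolynomial (Fin 4) k) (FractionRing (MvPolynomial (Fin 4) k)) q ∈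
      Algebra.adjoin k ((ι.range : Set (FractionRing (MvPolynomial (Fin 4) k))) ∪ {s⁻¹}) := fun q =>
    Algebra.subset_adjoin (Set.mem_union_left _ ⟨q, rfl⟩)
  have hsinv : s⁻¹ ∈ Algebra.adjoin k ((ι.range : Set (FractionRing (MvPolynomial (Fin 4) k))) ∪ {s⁻¹}) :=
    Algebra.subset_adjoin (Set.mem_union_right _ rfl)
  -- the monomials as fractions q / s^e, and their values on monomial arcs
  have hfrac : ∀ i : Fin 7, ∃ (q : MvPolynomial (Fin 4) k) (e : ℕ),
      GK i * s ^ e = algebraMap (MvPolynomial (Fin 4) k) (FractionRing (MvPolynomial (Fin 4) k)) q ∧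
      ∀ lam : Fin 4 → ℚ, MvPolynomial.aeval (fun i => HahnSeries.single (lam i) (1 : k)) q *
        HahnSeries.single (-((e : ℚ) * (lam 1 + lam 2 + lam 3))) (1 : k) =
        HahnSeries.single (![lam 2 + lam 3 - lam 1, lam 3, lam 2, lam 1, lam 0,
          lam 0 + lam 1 - lam 2, lam 0 + 2 * lam 1 - lam 2 - lam 3] i) 1 := by
    intro i
    fin_cases i
    · refine ⟨MvPolynomial.X 2 ^ 2 * MvPolynomial.X 3 ^ 2, 1, ?_, fun lam => ?_⟩
      · show GK 0 * s ^ 1 = _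
        rw [hG0, hs, map_mul, map_pow, map_pow, ← ht, ← ht]
        field_simp [ht0 1]
      · simp only [map_mul, map_pow, MvPolynomial.aeval_X, HahnSeries.single_pow, one_pow,
          HahnSeries.single_mul_single, mul_one, Nat.cast_one, one_mul]
        show _ = HahnSeries.single (lam 2 + lam 3 - lam 1) 1
        congr 1; simp only [nsmul_eq_mul]; push_cast; ring
    · refine ⟨MvPolynomial.X 3, 0, ?_, fun lam => ?_⟩
      · show GK 1 * s ^ 0 = _
        rw [hG1, pow_zero, mul_one, ht]
      · simp only [MvPolynomial.aeval_X, HahnSeries.single_mul_single, mul_one, Nat.cast_zero, zero_mul,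
          neg_zero, add_zero]
        rfl
    · refine ⟨MvPolynomial.X 2, 0, ?_, fun lam => ?_⟩
      · show GK 2 * s ^ 0 = _
        rw [hG2, pow_zero, mul_one, ht]
      · simp only [MvPolynomial.aeval_X, HahnSeries.single_mul_single, mul_one, Nat.cast_zero, zero_mul,
          neg_zero, add_zero]
        rfl
    · refine ⟨MvPolynomial.X 1, 0, ?_, fun lam => ?_⟩
      · show GK 3 * s ^ 0 = _
        rw [hG3, pow_zero, mul_one, ht]
      · simp only [MvPolynomial.aeval_X, HahnSeries.single_mul_single, mul_one, Nat.cast_zero, zero_mul,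
          neg_zero, add_zero]
        rfl
    · refine ⟨MvPolynomial.X 0, 0, ?_, fun lam => ?_⟩
      · show GK 4 * s ^ 0 = _
        rw [hG4, pow_zero, mul_one, ht]
      · simp only [MvPolynomial.aeval_X, HahnSeries.single_mul_single, mul_one, Nat.cast_zero, zero_mul,
          neg_zero, add_zero]
        rfl
    · refine ⟨MvPolynomial.X 0 * MvPolynomial.X 1 ^ 2 * MvPolynomial.X 3, 1, ?_, fun lam => ?_⟩
      · show GK 5 * s ^ 1 = _
        rw [hG5, hs, map_mul, map_mul, map_pow, ← ht, ← ht, ← ht]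
        field_simp [ht0 2]
      · simp only [map_mul, map_pow, MvPolynomial.aeval_X, HahnSeries.single_pow, one_pow,
          HahnSeries.single_mul_single, mul_one, Nat.cast_one, one_mul]
        show _ = HahnSeries.single (lam 0 + lam 1 - lam 2) 1
        congr 1; simp only [nsmul_eq_mul]; push_cast; ring
    · refine ⟨MvPolynomial.X 0 * MvPolynomial.X 1 ^ 3, 1, ?_, fun lam => ?_⟩
      · show GK 6 * s ^ 1 = _
        rw [hG6, hs, map_mul, map_pow, ← ht, ← ht]
        field_simp [ht0 2, ht0 3]
      · simp only [map_mul, map_pow, MvPolynomial.aeval_X, HahnSeries.single_pow, one_pow,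
          HahnSeries.single_mul_single, mul_one, Nat.cast_one, one_mul]
        show _ = HahnSeries.single (lam 0 + 2 * lam 1 - lam 2 - lam 3) 1
        congr 1; simp only [nsmul_eq_mul]; push_cast; ring
  have hBle : B ≤ Algebra.adjoin k ((ι.range : Set (FractionRing (MvPolynomial (Fin 4) k))) ∪ {s⁻¹}) := by
    rw [hB, Algebra.adjoin_le_iff]
    rintro _ ⟨i, rfl⟩
    obtain ⟨q, e, hqe, -⟩ := hfrac i
    have : GK i = algebraMap (MvPolynomial (Fin 4) k) (FractionRing (MvPolynomial (Fin 4) k)) q * (s ^ e)⁻¹ :=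
      (eq_mul_inv_iff_mul_eq₀ (pow_ne_zero e hs0)).mpr hqe
    rw [this]
    refine Subalgebra.mul_mem _ (hPol q) ?_
    rw [← inv_pow]
    exact Subalgebra.pow_mem _ hsinv e
  -- monomial arcs with prescribed weights, centred at m when all seven values are positive
  have harc : ∀ lam : Fin 4 → ℚ, (∀ i : Fin 7, (0 : ℚ) < ![lam 2 + lam 3 - lam 1, lam 3, lam 2, lam 1, lam 0,
        lam 0 + lam 1 - lam 2, lam 0 + 2 * lam 1 - lam 2 - lam 3] i) →
      ∃ a : {α : ↥B →ₐ[k] HahnSeries ℚ k // ∀ b ∈ m, 0 < (α b).orderTop}, ∀ i,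
        a.1 (G i) = HahnSeries.single (![lam 2 + lam 3 - lam 1, lam 3, lam 2, lam 1, lam 0,
          lam 0 + lam 1 - lam 2, lam 0 + 2 * lam 1 - lam 2 - lam 3] i) (1 : k) := by
    intro lam hpos
    obtain ⟨α, hα⟩ := ta_exists_monomial_arc lam B hBle
    have hval : ∀ i, α (G i) = HahnSeries.single (![lam 2 + lam 3 - lam 1, lam 3, lam 2, lam 1, lam 0,
          lam 0 + lam 1 - lam 2, lam 0 + 2 * lam 1 - lam 2 - lam 3] i) (1 : k) := by
      intro i
      obtain ⟨q, e, hqe, hv⟩ := hfrac i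
      have hbi : (G i : FractionRing (MvPolynomial (Fin 4) k)) =
          algebraMap (MvPolynomial (Fin 4) k) (FractionRing (MvPolynomial (Fin 4) k)) q * (s ^ e)⁻¹ := by
        rw [hG]; exact (eq_mul_inv_iff_mul_eq₀ (pow_ne_zero e hs0)).mpr hqe
      rw [hα (G i) q e hbi, hv lam]
    have hposα : ∀ i, 0 < (α (G i)).orderTop := fun i => by
      rw [hval i, HahnSeries.orderTop_single one_ne_zero]; exact_mod_cast hpos i
    exact ⟨⟨α, ta_arc_centred hm G hGm' hGgen α hposα⟩, hval⟩
  -- the four exposing arcs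
  have key : ∀ (j : Fin 7) (lam : Fin 4 → ℚ),
      (![lam 2 + lam 3 - lam 1, lam 3, lam 2, lam 1, lam 0, lam 0 + lam 1 - lam 2,
        lam 0 + 2 * lam 1 - lam 2 - lam 3] j = 1) →
      (∀ i : Fin 7, i ≠ j → (1 : ℚ) < ![lam 2 + lam 3 - lam 1, lam 3, lam 2, lam 1, lam 0,
        lam 0 + lam 1 - lam 2, lam 0 + 2 * lam 1 - lam 2 - lam 3] i) →
      ∃ a : {α : ↥B →ₐ[k] HahnSeries ℚ k // ∀ b ∈ m, 0 < (α b).orderTop},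
        a.1 (G j) = HahnSeries.single (1 : ℚ) (1 : k) ∧ ∀ i, i ≠ j → (1 : WithTop ℚ) < (a.1 (G i)).orderTop := by
    intro j lam hj1 hgt
    have hpos : ∀ i : Fin 7, (0 : ℚ) < ![lam 2 + lam 3 - lam 1, lam 3, lam 2, lam 1, lam 0,
        lam 0 + lam 1 - lam 2, lam 0 + 2 * lam 1 - lam 2 - lam 3] i := by
      intro i
      by_cases hij : i = j
      · rw [hij, hj1]; exact one_pos
      · exact one_pos.trans (hgt i hij)
    obtain ⟨a, ha⟩ := harc lam hpos
    refine ⟨a, by rw [ha j, hj1], fun i hi => ?_⟩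
    rw [ha i, HahnSeries.orderTop_single one_ne_zero]
    exact_mod_cast hgt i hi
  have hexp : ∀ j : Fin 7, j.val < 4 → ∃ a : {α : ↥B →ₐ[k] HahnSeries ℚ k // ∀ b ∈ m, 0 < (α b).orderTop},
      a.1 (G j) = HahnSeries.single (1 : ℚ) (1 : k) ∧ ∀ i, i ≠ j → (1 : WithTop ℚ) < (a.1 (G i)).orderTop := by
    intro j hj
    have hj' : j = 0 ∨ j = 1 ∨ j = 2 ∨ j = 3 := by
      rcases j with ⟨j, hj7⟩
      interval_cases j <;> simp
    rcases hj' with rfl | rfl | rfl | rfl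
    · refine key 0 ![2, 3, 2, 2] (by simp only [Fin.isValue, Matrix.cons_val]; norm_num) ?_
      intro i hi
      fin_cases i
      all_goals first | exact absurd rfl hi | (simp only [Fin.isValue, Matrix.cons_val]; norm_num)
    · refine key 1 ![3, 2, 3, 1] (by simp only [Fin.isValue, Matrix.cons_val]) ?_
      intro i hi
      fin_cases i
      all_goals first | exact absurd rfl hi | (simp only [Fin.isValue, Matrix.cons_val]; norm_num)
    · refine key 2 ![2, 2, 1, 3] (by simp only [Fin.isValue, Matrix.cons_val]) ?_
      intro i hi
      fin_cases i
      all_goals first | exact absurd rfl hi | (simp only [Fin.isValue, Matrix.cons_val]; norm_num)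
    · refine key 3 ![4, 1, 2, 2] (by simp only [Fin.isValue, Matrix.cons_val]) ?_
      intro i hi
      fin_cases i
      all_goals first | exact absurd rfl hi | (simp only [Fin.isValue, Matrix.cons_val]; norm_num)
  -- the vertex arc
  obtain ⟨a₀, ha₀⟩ := ta_vertex_arc hm G hGm' hGgen
  -- cotangent invariance: the straightener in the monomial coordinates
  have hgtop : Algebra.adjoin k (Set.range g) = ⊤ := adjoin_range_eq_top_of_adjoin_coe_eq B g hgK
  have hN : ∀ j : Fin 7, ∃ N : Fin n → k, G j - ∑ j', algebraMap k ↥B (N j') * g j' ∈ m ^ 2 :=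
    fun j => cotspan_firstOrder_of_mem m hm g hg hgtop (G j) (hGm' j)
  choose N hN using hN
  have hne : Nonempty {α : ↥B →ₐ[k] HahnSeries ℚ k // ∀ b ∈ m, 0 < (α b).orderTop} := ⟨a₀⟩
  obtain ⟨W₇, hW₇, φ₇, k1, k2, k3⟩ :=
    (stub_invariance m hm G hGm' hGgen g hg N hN hne 1).mpr ⟨W, hW, φ, h1, h2, h3⟩
  exact toricT_vertex_core G hGm' hrelA hrelB hrelC ⟨a₀, ha₀⟩ hexp ⟨W₇, hW₇, φ₇, k1, k2, k3⟩

end ToricTMain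

end Summit.ResolutionOfSingularities.ResolutionOfSingularities.Theorems

end
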